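import Summits.Ventures.Crystal3D.Theorems.StickyWulffConstantCoaxialWallLawSlotTriangle
import Summits.Ventures.Crystal3D.Theorems.StickyWulffConstantCoaxialWallLawTerracePropagation
import Summits.Ventures.Crystal3D.Theorems.StickyWulffConstantGenericWallFloorTwinFrame
import HarnessLib

/-!
# The word automaton of the co-axial cell, II: every move target carries a `60°` triangle of neighbours

HONEST FRAMING. Part of the venture `Summits/Ventures/Crystal3D` (cell `crystal3d-full`), helper for the
crux `CoaxialWallLaw` (stmt-Ventures-19481) of `route-Ventures-StickyWulffConstant`, REGISTERED line
`WallLedgerF` (planner cf-p1 gen 16), open stub `stub_coaxialTwoSlabAdhesion` (general fillings).  Brick W2 of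
the v2 (NET) line automaton (memo F-NET-AUTOMATON-v2 §7, evidence on the crux item).  The state certificate of
the word automaton is a TRIANGLE: three slots `a, b, c` pairwise at `60°` whose translates `y + F a, y + F b,
y + F c` lie in `X` (it pins the slot dozen of the class, `…SlotTriangle`).  This file shows that the certificate
PROPAGATES along the three kinds of moves:

* `triangle_after_full_step` — from a ball `y ∈ X` with a full `G`-shell, along a far slot `u` of a `{111}`
  normal `m` of `G`: the face `{−u, u' − u, u'' − u}` of the far triple;
* `triangle_after_cross` — from a coherent twin dozen of `(G, m)` (mirror balls present), along a far slot
  `G' p` of the MIRROR frame `G' = G − 2⟪G·, m⟫ m`: the mirror triple gives `{−p, p' − p, p'' − p}`;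
* `triangle_after_glide` — from a twin dozen of `(G, m)` along an EQUATORIAL slot `u` (`⟪G u, m⟫ = 0`):
  `u = ℓᵢ − ℓⱼ` for the negative triple `ℓ`, and `{ℓⱼ − ℓᵢ, ℓⱼ − ℓ_k, ℓⱼ}` works.
A `60°` triangle of slots is linearly independent (`linearIndependent_of_pairwise_half`, wulff-p2's
`…GenericWallFloorTwinFrame`), so the certificate feeds `line_step` / `walk_moves`.  Only membership facts are used (no kissing facts).

WHAT THIS IS NOT: not the stub; F-C1 not moved.
-/

noncomputable section

namespace Summit.Ventures.Crystal3D.Theorems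

open Summit.Ventures.Crystal3D Finset
open Literature.MathematicalPhysics.StatisticalMechanics (fccStacking)
open scoped InnerProductSpace

variable {X : Finset (EuclideanSpace ℝ (Fin 3))}

/-- The face spanned at the far end of a far slot: for the far triple `u₁, u₂, u₃` the slots
`−u₁, u₂ − u₁, u₃ − u₁` form a `60°` triangle. -/
theorem face_triangle {u₁ u₂ u₃ : EuclideanSpace ℝ (Fin 3)}
    (hu₁ : u₁ ∈ fccSlots) (hu₂ : u₂ ∈ fccSlots) (hu₃ : u₃ ∈ fccSlots)
    (i12 : ⟪u₁, u₂⟫_ℝ = 1 / 2) (i13 : ⟪u₁, u₃⟫_ℝ = 1 / 2) (i23 : ⟪u₂, u₃⟫_ℝ = 1 / 2) :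
    (-u₁ ∈ fccSlots ∧ u₂ - u₁ ∈ fccSlots ∧ u₃ - u₁ ∈ fccSlots) ∧
    ⟪-u₁, u₂ - u₁⟫_ℝ = 1 / 2 ∧ ⟪-u₁, u₃ - u₁⟫_ℝ = 1 / 2 ∧ ⟪u₂ - u₁, u₃ - u₁⟫_ℝ = 1 / 2 := by
  have h11 : ⟪u₁, u₁⟫_ℝ = 1 := by
    rw [real_inner_self_eq_norm_sq, norm_eq_one_of_mem_fccSlots hu₁, one_pow]
  have i21 : ⟪u₂, u₁⟫_ℝ = 1 / 2 := by rw [real_inner_comm]; exact i12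
  have i31 : ⟪u₃, u₁⟫_ℝ = 1 / 2 := by rw [real_inner_comm]; exact i13
  refine ⟨⟨neg_mem_fccSlots hu₁, sub_mem_fccSlots_of_inner_eq_half hu₂ hu₁ i21,
    sub_mem_fccSlots_of_inner_eq_half hu₃ hu₁ i31⟩, ?_, ?_, ?_⟩
  · rw [inner_neg_left, inner_sub_right, h11, i12]; norm_num
  · rw [inner_neg_left, inner_sub_right, h11, i13]; norm_num
  · rw [inner_sub_left, inner_sub_right, inner_sub_right, i23, i21, i13, h11]; norm_num

/-- **Triangle after a straight move from a full shell.**  See the module docstring. -/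
theorem triangle_after_full_step (G : EuclideanSpace ℝ (Fin 3) ≃ₗᵢ[ℝ] EuclideanSpace ℝ (Fin 3))
    {m : EuclideanSpace ℝ (Fin 3)} (hm : ‖m‖ = 1)
    (hmenu : ∀ w ∈ fccSlots, ⟪G w, m⟫_ℝ = 0 ∨ ⟪G w, m⟫_ℝ = Real.sqrt (2 / 3) ∨ ⟪G w, m⟫_ℝ = -Real.sqrt (2 / 3))
    {y : EuclideanSpace ℝ (Fin 3)} (hy : y ∈ X) (hfull : ∀ w ∈ fccSlots, y + G w ∈ X)
    {u : EuclideanSpace ℝ (Fin 3)} (hu : u ∈ fccSlots) (hum : ⟪G u, m⟫_ℝ = Real.sqrt (2 / 3)) :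
    ∃ a ∈ fccSlots, ∃ b ∈ fccSlots, ∃ c ∈ fccSlots,
      ⟪a, b⟫_ℝ = 1 / 2 ∧ ⟪a, c⟫_ℝ = 1 / 2 ∧ ⟪b, c⟫_ℝ = 1 / 2 ∧
      y + G u + G a ∈ X ∧ y + G u + G b ∈ X ∧ y + G u + G c ∈ X := by
  have hr : 0 < Real.sqrt (2 / 3) := Real.sqrt_pos.2 (by norm_num)
  obtain ⟨u₁, hu₁, u₂, hu₂, u₃, hu₃, -, -, -, i12, i13, i23, -, hcover⟩ := exists_far_frame G hm hmenu
  -- reorder the far triple so that `u` comes first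
  obtain ⟨v₂, hv₂, v₃, hv₃, j12, j13, j23⟩ : ∃ v₂ ∈ fccSlots, ∃ v₃ ∈ fccSlots,
      ⟪u, v₂⟫_ℝ = 1 / 2 ∧ ⟪u, v₃⟫_ℝ = 1 / 2 ∧ ⟪v₂, v₃⟫_ℝ = 1 / 2 := by
    rcases hcover u hu (by rw [hum]; exact hr) with rfl | rfl | rfl
    · exact ⟨u₂, hu₂, u₃, hu₃, i12, i13, i23⟩
    · exact ⟨u₁, hu₁, u₃, hu₃, by rw [real_inner_comm]; exact i12, i23, i13⟩
    · exact ⟨u₁, hu₁, u₂, hu₂, by rw [real_inner_comm]; exact i13, by rw [real_inner_comm]; exact i23, i12⟩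
  obtain ⟨⟨ha, hb, hc⟩, iab, iac, ibc⟩ := face_triangle hu hv₂ hv₃ j12 j13 j23
  refine ⟨-u, ha, v₂ - u, hb, v₃ - u, hc, iab, iac, ibc, ?_, ?_, ?_⟩
  · rw [map_neg, add_neg_cancel_right]; exact hy
  · rw [map_sub, add_add_sub_cancel]; exact hfull v₂ hv₂
  · rw [map_sub, add_add_sub_cancel]; exact hfull v₃ hv₃

/-- **Triangle after a crossing.**  See the module docstring. -/
theorem triangle_after_cross (G G' : EuclideanSpace ℝ (Fin 3) ≃ₗᵢ[ℝ] EuclideanSpace ℝ (Fin 3))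
    {m : EuclideanSpace ℝ (Fin 3)} (hm : ‖m‖ = 1)
    (hmenu : ∀ w ∈ fccSlots, ⟪G w, m⟫_ℝ = 0 ∨ ⟪G w, m⟫_ℝ = Real.sqrt (2 / 3) ∨ ⟪G w, m⟫_ℝ = -Real.sqrt (2 / 3))
    (hG' : ∀ x, G' x = G x - (2 * ⟪G x, m⟫_ℝ) • m)
    {y : EuclideanSpace ℝ (Fin 3)} (hy : y ∈ X)
    (hmir : ∀ w ∈ fccSlots, ⟪G w, m⟫_ℝ < 0 → y + (G w - (2 * ⟪G w, m⟫_ℝ) • m) ∈ X)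
    {p : EuclideanSpace ℝ (Fin 3)} (hp : p ∈ fccSlots) (hpm : ⟪G' p, m⟫_ℝ = Real.sqrt (2 / 3)) :
    ∃ a ∈ fccSlots, ∃ b ∈ fccSlots, ∃ c ∈ fccSlots,
      ⟪a, b⟫_ℝ = 1 / 2 ∧ ⟪a, c⟫_ℝ = 1 / 2 ∧ ⟪b, c⟫_ℝ = 1 / 2 ∧
      y + G' p + G' a ∈ X ∧ y + G' p + G' b ∈ X ∧ y + G' p + G' c ∈ X := by
  have hr : 0 < Real.sqrt (2 / 3) := Real.sqrt_pos.2 (by norm_num)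
  -- the menu and the mirror balls in terms of `G'`
  have hG'm : ∀ x, ⟪G' x, m⟫_ℝ = -⟪G x, m⟫_ℝ := by
    intro x; rw [hG', inner_sub_left, real_inner_smul_left, real_inner_self_eq_norm_sq, hm]; ring
  have hmenu' : ∀ w ∈ fccSlots,
      ⟪G' w, m⟫_ℝ = 0 ∨ ⟪G' w, m⟫_ℝ = Real.sqrt (2 / 3) ∨ ⟪G' w, m⟫_ℝ = -Real.sqrt (2 / 3) := by
    intro w hw
    rw [hG'm]
    rcases hmenu w hw with h | h | h
    · exact Or.inl (by rw [h, neg_zero])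
    · exact Or.inr (Or.inr (by rw [h]))
    · exact Or.inr (Or.inl (by rw [h, neg_neg]))
  have hpres : ∀ w ∈ fccSlots, ⟪G' w, m⟫_ℝ = Real.sqrt (2 / 3) → y + G' w ∈ X := by
    intro w hw h
    rw [hG']
    exact hmir w hw (by rw [hG'm] at h; linarith)
  obtain ⟨u₁, hu₁, u₂, hu₂, u₃, hu₃, hn₁, hn₂, hn₃, i12, i13, i23, -, hcover⟩ := exists_far_frame G' hm hmenu'
  obtain ⟨v₂, hv₂, v₃, hv₃, hv₂m, hv₃m, j12, j13, j23⟩ : ∃ v₂ ∈ fccSlots, ∃ v₃ ∈ fccSlots,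
      ⟪G' v₂, m⟫_ℝ = Real.sqrt (2 / 3) ∧ ⟪G' v₃, m⟫_ℝ = Real.sqrt (2 / 3) ∧
      ⟪p, v₂⟫_ℝ = 1 / 2 ∧ ⟪p, v₃⟫_ℝ = 1 / 2 ∧ ⟪v₂, v₃⟫_ℝ = 1 / 2 := by
    rcases hcover p hp (by rw [hpm]; exact hr) with rfl | rfl | rfl
    · exact ⟨u₂, hu₂, u₃, hu₃, hn₂, hn₃, i12, i13, i23⟩
    · exact ⟨u₁, hu₁, u₃, hu₃, hn₁, hn₃, by rw [real_inner_comm]; exact i12, i23, i13⟩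
    · exact ⟨u₁, hu₁, u₂, hu₂, hn₁, hn₂, by rw [real_inner_comm]; exact i13,
        by rw [real_inner_comm]; exact i23, i12⟩
  obtain ⟨⟨ha, hb, hc⟩, iab, iac, ibc⟩ := face_triangle hp hv₂ hv₃ j12 j13 j23
  refine ⟨-p, ha, v₂ - p, hb, v₃ - p, hc, iab, iac, ibc, ?_, ?_, ?_⟩
  · rw [map_neg, add_neg_cancel_right]; exact hy
  · rw [map_sub, add_add_sub_cancel]; exact hpres v₂ hv₂ hv₂m
  · rw [map_sub, add_add_sub_cancel]; exact hpres v₃ hv₃ hv₃m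

/-- The glide triangle, core computation: for the negative triple `ℓᵢ, ℓⱼ, ℓ_k` and `u = ℓᵢ − ℓⱼ`. -/
theorem glide_triangle_core (G : EuclideanSpace ℝ (Fin 3) ≃ₗᵢ[ℝ] EuclideanSpace ℝ (Fin 3))
    {m : EuclideanSpace ℝ (Fin 3)} {y ℓi ℓj ℓk : EuclideanSpace ℝ (Fin 3)}
    (hi : ℓi ∈ fccSlots) (hj : ℓj ∈ fccSlots) (hk : ℓk ∈ fccSlots)
    (iij : ⟪ℓi, ℓj⟫_ℝ = 1 / 2) (iik : ⟪ℓi, ℓk⟫_ℝ = 1 / 2) (ijk : ⟪ℓj, ℓk⟫_ℝ = 1 / 2)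
    (hni : ⟪G ℓi, m⟫_ℝ = -Real.sqrt (2 / 3)) (hnk : ⟪G ℓk, m⟫_ℝ = -Real.sqrt (2 / 3))
    (hy : y ∈ X) (hown : ∀ w ∈ fccSlots, ⟪G w, m⟫_ℝ ≤ 0 → y + G w ∈ X) :
    ∃ a ∈ fccSlots, ∃ b ∈ fccSlots, ∃ c ∈ fccSlots,
      ⟪a, b⟫_ℝ = 1 / 2 ∧ ⟪a, c⟫_ℝ = 1 / 2 ∧ ⟪b, c⟫_ℝ = 1 / 2 ∧
      y + G (ℓi - ℓj) + G a ∈ X ∧ y + G (ℓi - ℓj) + G b ∈ X ∧ y + G (ℓi - ℓj) + G c ∈ X := by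
  have hr : 0 < Real.sqrt (2 / 3) := Real.sqrt_pos.2 (by norm_num)
  have hjj : ⟪ℓj, ℓj⟫_ℝ = 1 := by rw [real_inner_self_eq_norm_sq, norm_eq_one_of_mem_fccSlots hj, one_pow]
  have iji : ⟪ℓj, ℓi⟫_ℝ = 1 / 2 := by rw [real_inner_comm]; exact iij
  have ikj : ⟪ℓk, ℓj⟫_ℝ = 1 / 2 := by rw [real_inner_comm]; exact ijk
  refine ⟨ℓj - ℓi, sub_mem_fccSlots_of_inner_eq_half hj hi iji, ℓj - ℓk, sub_mem_fccSlots_of_inner_eq_half hj hk ijk,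
    ℓj, hj, ?_, ?_, ?_, ?_, ?_, ?_⟩
  · simp only [inner_sub_left, inner_sub_right, hjj, ijk, iij, iik]; norm_num
  · simp only [inner_sub_left, hjj, iij]; norm_num
  · simp only [inner_sub_left, hjj, ikj]; norm_num
  · have e : y + G (ℓi - ℓj) + G (ℓj - ℓi) = y := by rw [map_sub, map_sub]; abel
    rw [e]; exact hy
  · have e : y + G (ℓi - ℓj) + G (ℓj - ℓk) = y + G (ℓi - ℓk) := by rw [map_sub, map_sub, map_sub]; abel
    rw [e]
    exact hown _ (sub_mem_fccSlots_of_inner_eq_half hi hk iik) (by rw [map_sub, inner_sub_left, hni, hnk]; linarith)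
  · have e : y + G (ℓi - ℓj) + G ℓj = y + G ℓi := by rw [map_sub]; abel
    rw [e]
    exact hown _ hi (by rw [hni]; linarith)

open scoped Classical in
/-- **Triangle after a glide along the composition plane.**  See the module docstring. -/
theorem triangle_after_glide (G : EuclideanSpace ℝ (Fin 3) ≃ₗᵢ[ℝ] EuclideanSpace ℝ (Fin 3))
    {m : EuclideanSpace ℝ (Fin 3)} (hm : ‖m‖ = 1)
    (hmenu : ∀ w ∈ fccSlots, ⟪G w, m⟫_ℝ = 0 ∨ ⟪G w, m⟫_ℝ = Real.sqrt (2 / 3) ∨ ⟪G w, m⟫_ℝ = -Real.sqrt (2 / 3))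
    {y : EuclideanSpace ℝ (Fin 3)} (hy : y ∈ X) (hown : ∀ w ∈ fccSlots, ⟪G w, m⟫_ℝ ≤ 0 → y + G w ∈ X)
    {u : EuclideanSpace ℝ (Fin 3)} (hu : u ∈ fccSlots) (hum : ⟪G u, m⟫_ℝ = 0) :
    ∃ a ∈ fccSlots, ∃ b ∈ fccSlots, ∃ c ∈ fccSlots,
      ⟪a, b⟫_ℝ = 1 / 2 ∧ ⟪a, c⟫_ℝ = 1 / 2 ∧ ⟪b, c⟫_ℝ = 1 / 2 ∧
      y + G u + G a ∈ X ∧ y + G u + G b ∈ X ∧ y + G u + G c ∈ X := by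
  have hr : 0 < Real.sqrt (2 / 3) := Real.sqrt_pos.2 (by norm_num)
  -- the negative triple `ℓ₁, ℓ₂, ℓ₃` = far triple of `−m`
  have hm' : ‖-m‖ = 1 := by rw [norm_neg, hm]
  have hmenu' : ∀ w ∈ fccSlots,
      ⟪G w, -m⟫_ℝ = 0 ∨ ⟪G w, -m⟫_ℝ = Real.sqrt (2 / 3) ∨ ⟪G w, -m⟫_ℝ = -Real.sqrt (2 / 3) := by
    intro w hw
    rw [inner_neg_right]
    rcases hmenu w hw with h | h | h
    · exact Or.inl (by rw [h, neg_zero])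
    · exact Or.inr (Or.inr (by rw [h]))
    · exact Or.inr (Or.inl (by rw [h, neg_neg]))
  obtain ⟨ℓ₁, hℓ₁, ℓ₂, hℓ₂, ℓ₃, hℓ₃, hn₁, hn₂, hn₃, i12, i13, i23, -, -⟩ := exists_far_frame G hm' hmenu'
  rw [inner_neg_right, neg_eq_iff_eq_neg] at hn₁ hn₂ hn₃
  have i21 : ⟪ℓ₂, ℓ₁⟫_ℝ = 1 / 2 := by rw [real_inner_comm]; exact i12
  have i31 : ⟪ℓ₃, ℓ₁⟫_ℝ = 1 / 2 := by rw [real_inner_comm]; exact i13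
  have i32 : ⟪ℓ₃, ℓ₂⟫_ℝ = 1 / 2 := by rw [real_inner_comm]; exact i23
  -- `u` is one of the twelve vectors of the dozen generated by the triangle `ℓ`
  have hcl := fccSlots_eq_image_of_triangle hℓ₁ hℓ₂ hℓ₃ i12 i13 i23
  have hu' := hu
  rw [hcl, mem_image] at hu'
  obtain ⟨i, -, hi⟩ := hu'
  fin_cases i <;> simp at hi <;> subst hi
  · rw [hn₁] at hum; linarith
  · rw [hn₂] at hum; linarith
  · rw [hn₃] at hum; linarith
  · rw [map_neg, inner_neg_left, hn₁] at hum; linarith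
  · rw [map_neg, inner_neg_left, hn₂] at hum; linarith
  · rw [map_neg, inner_neg_left, hn₃] at hum; linarith
  · exact glide_triangle_core G hℓ₁ hℓ₂ hℓ₃ i12 i13 i23 hn₁ hn₃ hy hown
  · exact glide_triangle_core G hℓ₂ hℓ₁ hℓ₃ i21 i23 i13 hn₂ hn₃ hy hown
  · exact glide_triangle_core G hℓ₁ hℓ₃ hℓ₂ i13 i12 i32 hn₁ hn₂ hy hown
  · exact glide_triangle_core G hℓ₃ hℓ₁ hℓ₂ i31 i32 i12 hn₃ hn₂ hy hown
  · exact glide_triangle_core G hℓ₂ hℓ₃ hℓ₁ i23 i21 i31 hn₂ hn₁ hy hown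
  · exact glide_triangle_core G hℓ₃ hℓ₂ hℓ₁ i32 i31 i21 hn₃ hn₁ hy hown

end Summit.Ventures.Crystal3D.Theorems

end
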